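import Mathlib
import Summits.QuantumFields.YangMills.Theses.XiPowWidening
import Literature.MathematicalPhysics.QuantumFieldTheory.LatticeGaugeShenZhuZhuProofs
import Literature.MathematicalPhysics.QuantumLattice.LatticeGaugeDLRGibbsProofs
import Literature.Probability.LatticeModels.GibbsSpecificationProofs
import HarnessLib

/-!
# Route `XiPowWidening` — crux r2 `CorrelatorRigidityG` (stmt-QuantumFields-22466) REDUCED IN THE KERNEL TO ITS ONE REGISTERED STUB:
# the DLR-decoupling half of the registered birth skeleton, landed (support file; seat `ym-line-sfw-p1` gen 6 for planner-of-record ym-idea-1)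

CREDIT.  Every declaration below is planner ym-idea-1 g0's (`Cruxes/CorrelatorRigidityG` line `birth`, skeleton v3 REGISTERED on
stmt-QuantumFields-22466 2026-08-27T22:28Z with the single stub `stub_boundaryInsensitivityG`; HOME mirror
`pub/ideators/ym-idea-1/bc/CorrelatorRigidityG_birth.lean`, namespace `…Cruxes.CorrelatorRigidityG.Birth`).  The landing seat changed only:
the namespace, this docstring, the docstrings, and — so that no `def … : Prop` is buried in a proof file — the two hypothesis schemas
`DLROscillation` / `BoundaryInsensitivityG` are SPELLED OUT in the theorem statements (the registered stub's signature is the hypothesis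
of `correlatorRigidityG_of_boundaryInsensitivityG` verbatim, so `exact correlatorRigidityG_of_boundaryInsensitivityG stub_boundaryInsensitivityG`
closes the crux once the stub lands).

CONTENT.
* `dlrOscillation` — **DLR DECOUPLING THROUGH ONE FINITE WINDOW** (PROVED): two DLR states `μ, ν ∈ 𝒢(ymSpecification r.ρ β)` of the
  SAME specification differ, on any bounded measurable observable `f`, by at most the oscillation over boundary data `η, η'` of the
  `Λ`-kernel expectation of `f`, for ANY finite edge window `Λ` (Georgii (1.26)–(1.28): `μ = μγ_Λ`; tree `isGibbsMeasure_iff_bind_holds`,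
  `isSpecification_ymSpecification_of_t2Space`, `measurable_ymSpecification_apply`, `Measure.lintegral_bind`; `T2Space` /
  `SecondCountableTopology` of `G` from the faithful representation `r`).
* `abs_corr_sub_corr_le` — arithmetic: the connected correlator is Lipschitz in its three ingredients.
* `correlatorRigidityG_of_boundaryInsensitivityG` — **THE COMPOSITION**: boundary insensitivity of the three correlator ingredients
  (`θF·α_nF`, `θF`, `α_nF`, `F = plaqCost0 r.ρ 1 2`) in SOME finite window, up to `C n^q β^{-a}` (`a > 2`) throughout `1 ≤ n ≤ 2β^A`,
  uniformly over ALL boundary data — the registered stub, verbatim — gives the route's crux `XiPowWidening.CorrelatorRigidityG` BY NAME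
  (measurability/boundedness of the ingredients from `continuous_bounded_plaqCost0`).

WHAT THIS IS NOT: the stub `BoundaryInsensitivityG` (weak-coupling two-sided bulk control for arbitrary boundary data; wall
`Literature.Barriers.QuantumFields.UVStabilityNonUniqueness` — near-uniqueness in a window) stays OPEN, so does the crux; nothing here
bears on the rung-R2ξ leaf `WeakCouplingRates.XiPow` beyond this reduction, and no summit / no mass gap is proved.
-/

noncomputable section

namespace Summit.QuantumFields.YangMills.Theorems.XiPowWideningCorrelatorRigidityG

open MeasureTheory Filter Topology
open scoped ENNReal
open Literature.MathematicalPhysics.QuantumFieldTheory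
open Literature.MathematicalPhysics.QuantumLattice
open Summit.QuantumFields.YangMills.Theorems.WeakCouplingRates

/-- **DLR DECOUPLING THROUGH ONE FINITE WINDOW** (every compact simple `G`, every faithful lattice representation `r`, every `β`):
two DLR states `μ, ν` of the Yang–Mills specification differ on a bounded measurable `f` by at most `ε` as soon as the `Λ`-kernel
expectations of `f` differ by at most `ε` over all pairs of boundary data, for one finite edge window `Λ` — `μ = μγ_Λ`, so
`∫ f dμ` is an average of kernel values, all of which lie in an interval of length `ε`. [cite: Georgii2011, Def. 1.23 / Rem. 1.24] -/
theorem dlrOscillation :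
    ∀ (G : Type) [Group G] [TopologicalSpace G] [IsTopologicalGroup G] [CompactSpace G],
      IsCompactSimpleLieGroup G → letI : MeasurableSpace G := borel G; haveI : BorelSpace G := ⟨rfl⟩;
      ∀ (r : LatticeRep G) (β : ℝ) (μ ν : Measure (LGConfig 4 G)),
        μ ∈ ymGibbsMeasures (d := 4) r.ρ β → ν ∈ ymGibbsMeasures (d := 4) r.ρ β →
        ∀ (Λ : Finset (Literature.MathematicalPhysics.QuantumLattice.ZdEdge 4)) (f : LGConfig 4 G → ℝ) (B ε : ℝ), Measurable f → (∀ U, |f U| ≤ B) →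
          (∀ η η' : LGConfig 4 G,
            |(∫ U, f U ∂(ymSpecification (d := 4) r.ρ β Λ η)) - ∫ U, f U ∂(ymSpecification (d := 4) r.ρ β Λ η')| ≤ ε) →
          |(∫ U, f U ∂μ) - ∫ U, f U ∂ν| ≤ ε := by
  intro G _ _ _ _ hG
  letI : MeasurableSpace G := borel G
  haveI : BorelSpace G := ⟨rfl⟩
  intro r β μ ν hμ hν Λ f B ε hfm hfB hosc
  classical
  -- topological prerequisites, from the faithful finite-dimensional representation
  haveI : T2Space G := T2Space.of_injective_continuous r.injective r.continuous
  haveI : SecondCountableTopology G :=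
    (r.continuous.isClosedEmbedding r.injective).isEmbedding.secondCountableTopology
  have hγ := isSpecification_ymSpecification_of_t2Space (d := 4) r.ρ r.continuous β
  -- DLR equations in bind form (tree: `isGibbsMeasure_iff_bind_holds`)
  have hμ' := (Literature.Probability.LatticeModels.isGibbsMeasure_iff_bind_holds hγ μ).mp hμ
  have hν' := (Literature.Probability.LatticeModels.isGibbsMeasure_iff_bind_holds hγ ν).mp hν
  haveI : IsProbabilityMeasure μ := hμ'.1
  haveI : IsProbabilityMeasure ν := hν'.1
  haveI hγP : ∀ η, IsProbabilityMeasure (ymSpecification (d := 4) r.ρ β Λ η) := fun η => hγ.isProbability Λ η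
  -- the kernel is a measurable measure-valued map
  have hκ : Measurable (ymSpecification (d := 4) r.ρ β Λ) :=
    Measure.measurable_of_measurable_coe _ fun A hA =>
      measurable_ymSpecification_apply (d := 4) r.ρ r.continuous β Λ hA
  -- signs
  let η₀ : LGConfig 4 G := fun _ => 1
  have hε : 0 ≤ ε := (abs_nonneg _).trans (hosc η₀ η₀)
  have hB : 0 ≤ B := (abs_nonneg _).trans (hfB η₀)
  -- the shifted non-negative integrand and its kernel integrals
  set g : LGConfig 4 G → ℝ≥0∞ := fun U => ENNReal.ofReal (f U + B) with hgdef
  have hgm : Measurable g := (hfm.add_const B).ennreal_ofReal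
  have hg_le : ∀ U, g U ≤ ENNReal.ofReal (2 * B) := fun U =>
    ENNReal.ofReal_le_ofReal (by have := (abs_le.mp (hfB U)).2; linarith)
  set I : LGConfig 4 G → ℝ≥0∞ := fun η => ∫⁻ U, g U ∂(ymSpecification (d := 4) r.ρ β Λ η) with hIdef
  have hI_le : ∀ η, I η ≤ ENNReal.ofReal (2 * B) := fun η =>
    calc I η ≤ ∫⁻ _U, ENNReal.ofReal (2 * B) ∂(ymSpecification (d := 4) r.ρ β Λ η) := lintegral_mono fun U => hg_le U
      _ = ENNReal.ofReal (2 * B) := by simp [lintegral_const, measure_univ]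
  have hI_ne : ∀ η, I η ≠ ∞ := fun η => ne_top_of_le_ne_top ENNReal.ofReal_ne_top (hI_le η)
  -- Bochner integral of `f` against a probability measure through the lintegral of `g`
  have key : ∀ (π : Measure (LGConfig 4 G)) [IsProbabilityMeasure π], ∫ U, f U ∂π = (∫⁻ U, g U ∂π).toReal - B := by
    intro π _
    have hint : Integrable f π :=
      (integrable_const B).mono' hfm.aestronglyMeasurable (ae_of_all _ fun U => by rw [Real.norm_eq_abs]; exact hfB U)
    have h1 : ∫ U, (f U + B) ∂π = (∫⁻ U, g U ∂π).toReal := by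
      rw [integral_eq_lintegral_of_nonneg_ae]
      · exact ae_of_all _ fun U => by have := (abs_le.mp (hfB U)).1; show (0 : ℝ) ≤ f U + B; linarith
      · exact (hfm.add_const B).aestronglyMeasurable
    have h2 : ∫ U, (f U + B) ∂π = (∫ U, f U ∂π) + B := by
      rw [integral_add hint (integrable_const B), integral_const, probReal_univ, one_smul]
    linarith
  have hkern : ∀ η, ∫ U, f U ∂(ymSpecification (d := 4) r.ρ β Λ η) = (I η).toReal - B := fun η => key _
  -- DLR: the lintegral of `g` is the average of the kernel lintegrals
  have hbind : ∀ (π : Measure (LGConfig 4 G)), π.bind (ymSpecification (d := 4) r.ρ β Λ) = π →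
      ∫⁻ U, g U ∂π = ∫⁻ η, I η ∂π := by
    intro π hπ
    calc ∫⁻ U, g U ∂π = ∫⁻ U, g U ∂(π.bind (ymSpecification (d := 4) r.ρ β Λ)) := by rw [hπ]
      _ = ∫⁻ η, I η ∂π := Measure.lintegral_bind hκ.aemeasurable hgm.aemeasurable
  -- sup and inf of the (real) kernel values
  set S : Set ℝ := Set.range fun η : LGConfig 4 G => (I η).toReal with hSdef
  have hSa : BddAbove S := ⟨2 * B, by
    rintro _ ⟨η, rfl⟩; exact ENNReal.toReal_le_of_le_ofReal (by linarith) (hI_le η)⟩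
  have hSb : BddBelow S := ⟨0, by rintro _ ⟨η, rfl⟩; exact ENNReal.toReal_nonneg⟩
  have hSne : S.Nonempty := ⟨_, η₀, rfl⟩
  have hi_le : ∀ η, sInf S ≤ (I η).toReal := fun η => csInf_le hSb ⟨η, rfl⟩
  have hle_s : ∀ η, (I η).toReal ≤ sSup S := fun η => le_csSup hSa ⟨η, rfl⟩
  have hi0 : 0 ≤ sInf S := le_csInf hSne (by rintro _ ⟨η, rfl⟩; exact ENNReal.toReal_nonneg)
  have his : sInf S ≤ sSup S := (hi_le η₀).trans (hle_s η₀)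
  have hsi : sSup S - sInf S ≤ ε := by
    have h2 : ∀ η η', (I η).toReal ≤ (I η').toReal + ε := fun η η' => by
      have h := hosc η η'
      rw [hkern, hkern] at h
      have := (abs_le.mp h).2
      linarith
    have h3 : ∀ η', sSup S ≤ (I η').toReal + ε := fun η' =>
      csSup_le hSne (by rintro _ ⟨η, rfl⟩; exact h2 η η')
    have h4 : sSup S - ε ≤ sInf S := le_csInf hSne (by rintro _ ⟨η', rfl⟩; linarith [h3 η'])
    linarith
  -- averages of `I` against probability measures lie in `[inf, sup]`
  have havg : ∀ (π : Measure (LGConfig 4 G)) [IsProbabilityMeasure π],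
      sInf S ≤ (∫⁻ η, I η ∂π).toReal ∧ (∫⁻ η, I η ∂π).toReal ≤ sSup S := by
    intro π _
    have hup : ∫⁻ η, I η ∂π ≤ ENNReal.ofReal (sSup S) :=
      calc ∫⁻ η, I η ∂π ≤ ∫⁻ _η, ENNReal.ofReal (sSup S) ∂π := lintegral_mono fun η => by
              rw [← ENNReal.ofReal_toReal (hI_ne η)]; exact ENNReal.ofReal_le_ofReal (hle_s η)
        _ = ENNReal.ofReal (sSup S) := by simp [lintegral_const, measure_univ]
    have hlo : ENNReal.ofReal (sInf S) ≤ ∫⁻ η, I η ∂π :=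
      calc ENNReal.ofReal (sInf S) = ∫⁻ _η, ENNReal.ofReal (sInf S) ∂π := by simp [lintegral_const, measure_univ]
        _ ≤ ∫⁻ η, I η ∂π := lintegral_mono fun η => by
              rw [← ENNReal.ofReal_toReal (hI_ne η)]; exact ENNReal.ofReal_le_ofReal (hi_le η)
    have hne : ∫⁻ η, I η ∂π ≠ ∞ := ne_top_of_le_ne_top ENNReal.ofReal_ne_top hup
    refine ⟨?_, ?_⟩
    · have h := ENNReal.toReal_mono hne hlo
      rwa [ENNReal.toReal_ofReal hi0] at h
    · have h := ENNReal.toReal_mono ENNReal.ofReal_ne_top hup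
      rwa [ENNReal.toReal_ofReal (hi0.trans his)] at h
  -- conclude
  rw [key μ, key ν, hbind μ (hμ'.2 Λ), hbind ν (hν'.2 Λ)]
  obtain ⟨h1, h2⟩ := havg μ
  obtain ⟨h3, h4⟩ := havg ν
  rw [abs_le]
  constructor <;> linarith

/-- Pure algebra: the connected correlator `I − a·b` is Lipschitz in its three ingredients (`|a_μ|, |b_ν| ≤ B`). [folklore] -/
theorem abs_corr_sub_corr_le {Iμ Iν aμ aν bμ bν B ε : ℝ} (hI : |Iμ - Iν| ≤ ε) (ha : |aμ - aν| ≤ ε) (hb : |bμ - bν| ≤ ε)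
    (haμ : |aμ| ≤ B) (hbν : |bν| ≤ B) :
    |(Iμ - aμ * bμ) - (Iν - aν * bν)| ≤ (1 + 2 * B) * ε := by
  have hε : 0 ≤ ε := (abs_nonneg _).trans hI
  have key : (Iμ - aμ * bμ) - (Iν - aν * bν) = (Iμ - Iν) - (aμ * (bμ - bν) + bν * (aμ - aν)) := by ring
  rw [key]
  calc |(Iμ - Iν) - (aμ * (bμ - bν) + bν * (aμ - aν))|
      ≤ |Iμ - Iν| + |aμ * (bμ - bν) + bν * (aμ - aν)| := abs_sub _ _
    _ ≤ |Iμ - Iν| + (|aμ| * |bμ - bν| + |bν| * |aμ - aν|) := by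
        refine add_le_add le_rfl ((abs_add_le _ _).trans ?_)
        rw [abs_mul, abs_mul]
    _ ≤ ε + (B * ε + B * ε) :=
        add_le_add hI (add_le_add (mul_le_mul haμ hb (abs_nonneg _) ((abs_nonneg _).trans haμ))
          (mul_le_mul hbν ha (abs_nonneg _) ((abs_nonneg _).trans hbν)))
    _ = (1 + 2 * B) * ε := by ring

/-- **THE CRUX FROM ITS REGISTERED STUB**: boundary insensitivity of the three correlator ingredients in some finite window, up to
`C n^q β^{-a}` (`a > 2`) for `1 ≤ n ≤ 2β^A`, uniformly over all boundary data (the registered stub `stub_boundaryInsensitivityG` of the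
`birth` line, VERBATIM as the hypothesis) ⇒ `XiPowWidening.CorrelatorRigidityG` BY NAME, through `dlrOscillation` applied to the three
ingredients and `abs_corr_sub_corr_le` (constant `(1 + 2B)·C`, `B` the sup of `plaqCost0`).  CONDITIONAL on the open stub; no summit.
[cite: Georgii2011, Def. 1.23 / Rem. 1.24] -/
theorem correlatorRigidityG_of_boundaryInsensitivityG
    (h2 :
      ∀ (G : Type) [Group G] [TopologicalSpace G] [IsTopologicalGroup G] [CompactSpace G],
        IsCompactSimpleLieGroup G → letI : MeasurableSpace G := borel G; haveI : BorelSpace G := ⟨rfl⟩;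
        ∀ r : LatticeRep G, ∃ A C β₀ a : ℝ, ∃ q : ℕ, 0 < A ∧ 2 < a ∧ 0 ≤ C ∧ ∀ β : ℝ, β₀ ≤ β →
          ∀ n : ℕ, 1 ≤ n → (n : ℝ) ≤ 2 * β ^ A → ∃ Λ : Finset (Literature.MathematicalPhysics.QuantumLattice.ZdEdge 4), ∀ η η' : LGConfig 4 G,
            |(∫ U, plaqCost0 r.ρ (1 : Fin 4) 2 (timeReflectLG U) * plaqCost0 r.ρ (1 : Fin 4) 2 (timeShiftLG (G := G) n U)
                  ∂(ymSpecification (d := 4) r.ρ β Λ η)) -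
                ∫ U, plaqCost0 r.ρ (1 : Fin 4) 2 (timeReflectLG U) * plaqCost0 r.ρ (1 : Fin 4) 2 (timeShiftLG (G := G) n U)
                  ∂(ymSpecification (d := 4) r.ρ β Λ η')| ≤ C * (n : ℝ) ^ q * β ^ (-a) ∧
            |(∫ U, plaqCost0 r.ρ (1 : Fin 4) 2 (timeReflectLG U) ∂(ymSpecification (d := 4) r.ρ β Λ η)) -
                ∫ U, plaqCost0 r.ρ (1 : Fin 4) 2 (timeReflectLG U) ∂(ymSpecification (d := 4) r.ρ β Λ η')| ≤ C * (n : ℝ) ^ q * β ^ (-a) ∧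
            |(∫ U, plaqCost0 r.ρ (1 : Fin 4) 2 (timeShiftLG (G := G) n U) ∂(ymSpecification (d := 4) r.ρ β Λ η)) -
                ∫ U, plaqCost0 r.ρ (1 : Fin 4) 2 (timeShiftLG (G := G) n U) ∂(ymSpecification (d := 4) r.ρ β Λ η')| ≤
              C * (n : ℝ) ^ q * β ^ (-a)) :
    Summit.QuantumFields.YangMills.Theses.XiPowWidening.CorrelatorRigidityG := by
  have h1 := dlrOscillation
  intro G _ _ _ _ hG
  letI : MeasurableSpace G := borel G
  haveI : BorelSpace G := ⟨rfl⟩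
  intro r
  obtain ⟨A, C, β₀, a, q, hA, ha, hC, H⟩ := h2 G hG r
  obtain ⟨hFc, B, hB⟩ := continuous_bounded_plaqCost0 (d := 4) r.ρ r.continuous (1 : Fin 4) 2
  have hB0 : 0 ≤ B := (abs_nonneg _).trans (hB fun _ => 1)
  refine ⟨A, (1 + 2 * B) * C, β₀, a, q, hA, ha, ?_⟩
  intro β hβ μ ν hμ hν hμP hνP _ _ n hn hnβ
  obtain ⟨Λ, hΛ⟩ := H β hβ n hn hnβ
  -- measurability of the three ingredients
  haveI : SecondCountableTopology G :=
    (r.continuous.isClosedEmbedding r.injective).isEmbedding.secondCountableTopology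
  have hFm : Measurable (plaqCost0 (d := 4) r.ρ (1 : Fin 4) 2) := hFc.measurable
  have hθm : Measurable (timeReflectLG (d := 4) (G := G)) := by
    refine measurable_pi_lambda _ fun e => ?_
    by_cases he : e.2 = 0
    · simp only [timeReflectLG, he, if_true]
      exact (measurable_pi_apply _).inv
    · simp only [timeReflectLG, he, if_false]
      exact measurable_pi_apply _
  have hαm : Measurable (timeShiftLG (d := 4) (G := G) n) := (timeShiftLG (d := 4) (G := G) n).measurable
  have ham : Measurable fun U => plaqCost0 (d := 4) r.ρ (1 : Fin 4) 2 (timeReflectLG U) := hFm.comp hθm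
  have hbm : Measurable fun U => plaqCost0 (d := 4) r.ρ (1 : Fin 4) 2 (timeShiftLG (G := G) n U) := hFm.comp hαm
  have hgm : Measurable fun U =>
      plaqCost0 (d := 4) r.ρ (1 : Fin 4) 2 (timeReflectLG U) * plaqCost0 (d := 4) r.ρ (1 : Fin 4) 2 (timeShiftLG (G := G) n U) :=
    ham.mul hbm
  -- bounds of the three ingredients
  have hab : ∀ U, |plaqCost0 (d := 4) r.ρ (1 : Fin 4) 2 (timeReflectLG U)| ≤ B := fun U => hB _
  have hbb : ∀ U, |plaqCost0 (d := 4) r.ρ (1 : Fin 4) 2 (timeShiftLG (G := G) n U)| ≤ B := fun U => hB _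
  have hgb : ∀ U, |plaqCost0 (d := 4) r.ρ (1 : Fin 4) 2 (timeReflectLG U) *
      plaqCost0 (d := 4) r.ρ (1 : Fin 4) 2 (timeShiftLG (G := G) n U)| ≤ B * B := fun U => by
    rw [abs_mul]; exact mul_le_mul (hab U) (hbb U) (abs_nonneg _) hB0
  -- the three decouplings
  have dI := h1 G hG r β μ ν hμ hν Λ _ (B * B) _ hgm hgb (fun η η' => (hΛ η η').1)
  have da := h1 G hG r β μ ν hμ hν Λ _ B _ ham hab (fun η η' => (hΛ η η').2.1)
  have db := h1 G hG r β μ ν hμ hν Λ _ B _ hbm hbb (fun η η' => (hΛ η η').2.2)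
  -- the one-state bounds |⟨θF⟩_μ|, |⟨α_nF⟩_ν| ≤ B
  have haμ : |∫ U, plaqCost0 (d := 4) r.ρ (1 : Fin 4) 2 (timeReflectLG U) ∂μ| ≤ B := by
    have h := norm_integral_le_of_norm_le_const (μ := μ) (C := B)
      (f := fun U => plaqCost0 (d := 4) r.ρ (1 : Fin 4) 2 (timeReflectLG U))
      (Eventually.of_forall fun U => by simpa only [Real.norm_eq_abs] using hab U)
    rw [Real.norm_eq_abs, probReal_univ, mul_one] at h
    exact h
  have hbν : |∫ U, plaqCost0 (d := 4) r.ρ (1 : Fin 4) 2 (timeShiftLG (G := G) n U) ∂ν| ≤ B := by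
    have h := norm_integral_le_of_norm_le_const (μ := ν) (C := B)
      (f := fun U => plaqCost0 (d := 4) r.ρ (1 : Fin 4) 2 (timeShiftLG (G := G) n U))
      (Eventually.of_forall fun U => by simpa only [Real.norm_eq_abs] using hbb U)
    rw [Real.norm_eq_abs, probReal_univ, mul_one] at h
    exact h
  have hfin := abs_corr_sub_corr_le dI da db haμ hbν
  simp only [rpCorr]
  refine hfin.trans_eq ?_
  ring

end Summit.QuantumFields.YangMills.Theorems.XiPowWideningCorrelatorRigidityG

end
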